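import Summits.QuantumAdvantage.AdviceFreeQNC0.R1OneFibre39
import HarnessLib

/-!
# Cell qa-qnc0, `p = 3` — (R1) for PAIRWISE-DISJOINT scattered outside reads, every `C` (prover qn-prover-3 g25; sequel of
# `R1OneFibre39.lean`)

The transversal form of (R1) (`AffBells22.norm_twistedWinSum_le_of_transversal`: reading sets `T k`, a transversal `A ⊆ supp β`
with `#(T k ∩ A) ≤ 1` ⇒ twisted odd-class win sum `≤ 2·(39/40)^{#A}·2^N`) reduces (R1) = `TwistedJunta36.TwistedJuntaBoundX3S` to the
existence of a transversal of size `≍ #(supp β ∖ W)/(log₂N)^C` for the OUTSIDE reads `T k ∖ W`.  Such a transversal always exists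
when the outside reads are pairwise disjoint (keep the least twisted letter of each outside-read set and every unread twisted letter):

* `AffBells22.exists_transversal_of_pairwiseDisjoint` — sets `R k ⊆ D` of size `≤ s`, `s ≥ 1`, pairwise disjoint ⇒ `∃ A ⊆ D`,
  `#(R k ∩ A) ≤ 1` for all `k`, `#D ≤ s·#A`;
* **`AffBells22.norm_twistedWinSum_le_of_disjointReads`** — bells reading `x|_W` (ANY `W`) plus pairwise-disjoint outside sets of size
  `≤ s`: `‖Σ_x e₃(β·x)[OddZeros x ∧ Rel x (g x)]‖ ≤ 2·(39/40)^{#(supp β ∖ W)/s}·2^N` (`N ≥ 3`, `s ≥ 1`);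
* **`GradedSeeds38.twistedJuntaBoundX3S_of_disjointReads`** — the statement of (R1) `TwistedJuntaBoundX3S (39/40)` VERBATIM with the one
  extra hypothesis that the outside reads `T k ∖ W` are pairwise disjoint (every `C`; `3·#W ≤ N` unused; `A = 1`, `n₀ = 3`).

So what is left of (R1) is the regime of heavily OVERLAPPING outside reads with no large transversal (pair-dense families of
`(log₂N)^C`-sets on `≍ (log₂N)^C·√N` twisted letters — planner qa-qnc0-p1's Claim K regime, ROUND-38 §6.2, and p2's ROUND-38P2 §9).

WHAT THIS IS NOT: (R1) for overlapping outside reads is untouched; crux `stmt-QuantumAdvantage-22907` untouched.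
-/

noncomputable section

namespace Summit.QuantumAdvantage.AdviceFreeQNC0

open Finset Literature.Computability.QuantumComplexity Literature.Computability.QuantumComplexity.RingHLF
open Literature.Computability.MetaComplexity
open scoped Classical

namespace AffBells22

variable {N : ℕ}

/-- **Transversals of pairwise-disjoint families.**  If the sets `R k ⊆ D` have at most `s ≥ 1` elements each and are pairwise
disjoint, then some `A ⊆ D` meets every `R k` at most once and has `#D ≤ s·#A` (`A` = the elements of `D` that are least in every
`R k` containing them: the minimum of each non-empty `R k` and every element of `D` in no `R k`). -/
theorem exists_transversal_of_pairwiseDisjoint {κ : Type*} [Fintype κ] (D : Finset (Fin N)) (R : κ → Finset (Fin N)) (s : ℕ)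
    (hs : 1 ≤ s) (hRD : ∀ k, R k ⊆ D) (hRs : ∀ k, (R k).card ≤ s)
    (hdisj : ∀ k k', k ≠ k' → Disjoint (R k) (R k')) :
    ∃ A ⊆ D, (∀ k, (R k ∩ A).card ≤ 1) ∧ D.card ≤ s * A.card := by
  classical
  set A := D.filter (fun j => ∀ k, j ∈ R k → ∀ j' ∈ R k, j ≤ j') with hAdef
  have hAD : A ⊆ D := filter_subset _ _
  have hA1 : ∀ k, (R k ∩ A).card ≤ 1 := by
    intro k
    refine card_le_one.mpr fun j hj j' hj' => ?_
    rw [mem_inter] at hj hj'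
    exact le_antisymm ((mem_filter.mp hj.2).2 k hj.1 j' hj'.1) ((mem_filter.mp hj'.2).2 k hj'.1 j hj.1)
  refine ⟨A, hAD, hA1, ?_⟩
  -- each non-empty `R k` meets `A` (at its minimum), so `#R k ≤ s · #(R k ∩ A)`
  have hRk : ∀ k, (R k).card ≤ s * (R k ∩ A).card := by
    intro k
    rcases (R k).eq_empty_or_nonempty with h0 | hne
    · rw [h0]; simp
    · have hmin : (R k).min' hne ∈ R k ∩ A := by
        refine mem_inter.mpr ⟨min'_mem _ hne, mem_filter.mpr ⟨hRD k (min'_mem _ hne), fun k₂ hk₂ j' hj' => ?_⟩⟩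
        have hkk : k₂ = k := by
          by_contra hne2
          exact disjoint_left.mp (hdisj k₂ k hne2) hk₂ (min'_mem _ hne)
        subst hkk
        exact min'_le _ _ hj'
      have h1 : 1 ≤ (R k ∩ A).card := card_pos.mpr ⟨_, hmin⟩
      calc (R k).card ≤ s * 1 := by rw [mul_one]; exact hRs k
        _ ≤ s * (R k ∩ A).card := Nat.mul_le_mul_left s h1
  -- the read part `B` of `D`
  set B := (univ : Finset κ).biUnion R with hBdef
  have hBD : B ⊆ D := biUnion_subset.mpr fun k _ => hRD k
  have hdisj' : ∀ k ∈ (univ : Finset κ), ∀ k' ∈ (univ : Finset κ), k ≠ k' → Disjoint (R k) (R k') :=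
    fun k _ k' _ h => hdisj k k' h
  have hBcard : B.card = ∑ k, (R k).card := card_biUnion hdisj'
  have hBA : B ∩ A = (univ : Finset κ).biUnion (fun k => R k ∩ A) := by
    rw [hBdef, biUnion_inter]
  have hdisjA : ∀ k ∈ (univ : Finset κ), ∀ k' ∈ (univ : Finset κ), k ≠ k' → Disjoint (R k ∩ A) (R k' ∩ A) :=
    fun k _ k' _ h => (hdisj k k' h).mono inter_subset_left inter_subset_left
  have hBAcard : (B ∩ A).card = ∑ k, (R k ∩ A).card := by rw [hBA]; exact card_biUnion hdisjA
  have hB_le : B.card ≤ s * (B ∩ A).card := by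
    rw [hBcard, hBAcard, mul_sum]
    exact sum_le_sum fun k _ => hRk k
  -- the unread part `U` of `D` lies in `A`
  set U := D \ B with hUdef
  have hUA : U ⊆ A := by
    intro j hj
    rw [mem_sdiff] at hj
    refine mem_filter.mpr ⟨hj.1, fun k hk => ?_⟩
    exact absurd (mem_biUnion.mpr ⟨k, mem_univ _, hk⟩) hj.2
  have hDcard : D.card = U.card + B.card := (card_sdiff_add_card_eq_card hBD).symm
  have hAeq : A = U ∪ (B ∩ A) := by
    ext j
    constructor
    · intro hj
      by_cases hjB : j ∈ B
      · exact mem_union_right _ (mem_inter.mpr ⟨hjB, hj⟩)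
      · exact mem_union_left _ (mem_sdiff.mpr ⟨hAD hj, hjB⟩)
    · intro hj
      rcases mem_union.mp hj with h | h
      · exact hUA h
      · exact (mem_inter.mp h).2
  have hdj : Disjoint U (B ∩ A) :=
    disjoint_left.mpr fun j hjU hjBA => (mem_sdiff.mp hjU).2 (mem_inter.mp hjBA).1
  have hAcard : A.card = U.card + (B ∩ A).card := by
    have := congrArg Finset.card hAeq
    rw [card_union_of_disjoint hdj] at this
    exact this
  have hU_le : U.card ≤ s * U.card := Nat.le_mul_of_pos_left _ hs
  calc D.card = U.card + B.card := hDcard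
    _ ≤ s * U.card + s * (B ∩ A).card := Nat.add_le_add hU_le hB_le
    _ = s * A.card := by rw [hAcard, mul_add]

/-- **(R1) for PAIRWISE-DISJOINT outside reads.**  If bell `k` reads only `T k`, the outside parts `T k ∖ W` have at most `s ≥ 1`
letters and are pairwise disjoint (`W` ARBITRARY), then
`‖Σ_x e₃(β·x)[OddZeros x ∧ Rel x (g x)]‖ ≤ 2·(39/40)^{#(supp β ∖ W)/s}·2^N` (`N ≥ 3`). -/
theorem norm_twistedWinSum_le_of_disjointReads (hN : 3 ≤ N) {s : ℕ} (hs : 1 ≤ s) (W : Finset (Fin N))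
    (T : Fin N → Finset (Fin N)) (g : Fin N → (Fin N → Bool) → Bool) (hg : ∀ k, ReadsOnly (T k) (g k))
    (hTs : ∀ k, (T k \ W).card ≤ s) (hdisj : ∀ k k', k ≠ k' → Disjoint (T k \ W) (T k' \ W)) (β : Fin N → ZMod 3) :
    ‖∑ x : Fin N → Bool, (ZMod.stdAddChar (∑ i : Fin N, if x i then β i else 0) : ℂ) *
        (if (OddZeros x ∧ RingHLF.Rel x (fun k => g k x)) then (1 : ℂ) else 0)‖
      ≤ 2 * (39 / 40 : ℝ) ^ ((univ.filter fun j : Fin N => j ∉ W ∧ β j ≠ 0).card / s) * (2 : ℝ) ^ N := by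
  classical
  set D := univ.filter (fun j : Fin N => j ∉ W ∧ β j ≠ 0) with hDdef
  set R : Fin N → Finset (Fin N) := fun k => (T k \ W) ∩ D with hRdef
  have hRD : ∀ k, R k ⊆ D := fun k => inter_subset_right
  have hRs : ∀ k, (R k).card ≤ s := fun k => (card_le_card inter_subset_left).trans (hTs k)
  have hRdisj : ∀ k k', k ≠ k' → Disjoint (R k) (R k') :=
    fun k k' h => (hdisj k k' h).mono inter_subset_left inter_subset_left
  obtain ⟨A, hAD, hA1, hDA⟩ := exists_transversal_of_pairwiseDisjoint D R s hs hRD hRs hRdisj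
  have hA : ∀ k, (T k ∩ A).card ≤ 1 := by
    intro k
    have hsub : T k ∩ A ⊆ R k ∩ A := by
      intro j hj
      rw [mem_inter] at hj
      have hjD := hAD hj.2
      exact mem_inter.mpr ⟨mem_inter.mpr ⟨mem_sdiff.mpr ⟨hj.1, (mem_filter.mp hjD).2.1⟩, hjD⟩, hj.2⟩
    exact (card_le_card hsub).trans (hA1 k)
  have hAβ : ∀ j ∈ A, β j ≠ 0 := fun j hj => (mem_filter.mp (hAD hj)).2.2
  refine (norm_twistedWinSum_le_of_transversal hN T g hg β A hA hAβ).trans ?_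
  have hdiv : D.card / s ≤ A.card := Nat.div_le_of_le_mul hDA
  have hpow : (39 / 40 : ℝ) ^ A.card ≤ (39 / 40 : ℝ) ^ (D.card / s) :=
    pow_le_pow_of_le_one (by norm_num) (by norm_num) hdiv
  have h2 : (0 : ℝ) ≤ (2 : ℝ) ^ N := by positivity
  nlinarith [hpow, h2]

end AffBells22

namespace GradedSeeds38

open AffBells22

/-- **(R1) `TwistedJunta36.TwistedJuntaBoundX3S (39/40)` for PAIRWISE-DISJOINT outside reads** — the statement of (R1) verbatim
(`∀ C, ∃ A n₀, …`, exponent `#(supp β ∖ W)/(log₂N)^C`) with the single extra hypothesis that the sets `T k ∖ W` are pairwise disjoint.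
(`A = 1`, `n₀ = 3`; the hypothesis `3·#W ≤ N` is not used.) -/
theorem twistedJuntaBoundX3S_of_disjointReads (C : ℕ) :
    ∃ A n₀ : ℕ, ∀ N ≥ n₀,
      ∀ (W : Finset (Fin N)) (T : Fin N → Finset (Fin N)) (g : Fin N → (Fin N → Bool) → Bool),
        3 * W.card ≤ N → (∀ k, (T k \ W).card ≤ (Nat.log 2 N) ^ C) →
        (∀ k k', k ≠ k' → Disjoint (T k \ W) (T k' \ W)) →
        (∀ k (x x' : Fin N → Bool), (∀ i ∈ T k, x i = x' i) → g k x = g k x') →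
          ∀ β : Fin N → ZMod 3,
            ‖∑ x : Fin N → Bool, (ZMod.stdAddChar (∑ i : Fin N, if x i then β i else 0) : ℂ) *
                (if (OddZeros x ∧ RingHLF.Rel x (fun k => g k x)) then (1 : ℂ) else 0)‖
              ≤ (N : ℝ) ^ A * (39 / 40 : ℝ) ^ ((univ.filter fun i : Fin N => i ∉ W ∧ β i ≠ 0).card / (Nat.log 2 N) ^ C)
                  * (2 : ℝ) ^ N := by
  classical
  refine ⟨1, 3, fun N hN W T g _hW hT hdisj hg β => ?_⟩
  have hlog : 1 ≤ Nat.log 2 N := Nat.le_log_of_pow_le (by norm_num) (by omega)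
  have hs : 1 ≤ (Nat.log 2 N) ^ C := Nat.one_le_pow _ _ hlog
  have hTr : ∀ k, ReadsOnly (T k) (g k) := fun k x x' h => hg k x x' h
  have h := norm_twistedWinSum_le_of_disjointReads hN hs W T g hTr hT hdisj β
  rw [pow_one]
  refine h.trans ?_
  have hN2 : (2 : ℝ) ≤ (N : ℝ) := by exact_mod_cast (show 2 ≤ N by omega)
  have hpos : (0 : ℝ) ≤ (39 / 40 : ℝ) ^ ((univ.filter fun i : Fin N => i ∉ W ∧ β i ≠ 0).card / (Nat.log 2 N) ^ C)
      * (2 : ℝ) ^ N := by positivity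
  nlinarith [hpos, hN2]

end GradedSeeds38

end Summit.QuantumAdvantage.AdviceFreeQNC0

end
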